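import Literature.RepresentationTheory.HeisenbergGroup.WeylSystemVacuumExtension
import Literature.RepresentationTheory.HeisenbergGroup.WeylSystemCommutingAction
import HarnessLib

/-!
# Gluing a Weyl system with a commuting action: an intertwiner of the vacuum representations extends to a joint intertwiner (von Neumann 1931, §5)

Topic `RepresentationTheory/HeisenbergGroup`; namespace `Literature.RepresentationTheory.HeisenbergGroup`.

Setting: Weyl systems `W₁`, `W₂` over the same `(V, J)` on Hilbert spaces `E₁`, `E₂`, and isometric actions `τ₁`, `τ₂`
of a group `G` commuting with them (two commuting Heisenberg groups — two places — one of them in Weyl form).  The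
actions preserve the vacuum subspaces `M₁`, `M₂` (`WeylSystemCommutingAction`).  **Theorem
`exists_linearIsometryEquiv_of_vacuumIntertwiner`**: a bounded operator `T : E₁ → E₂` that is isometric on `M₁`, maps
`M₁` ONTO `M₂` and intertwines `τ₁|M₁` with `τ₂|M₂` extends — through `WeylSystemVacuumExtension` — to a unitary
`U : E₁ ≃ₗᵢ[ℂ] E₂` intertwining BOTH `W₁, W₂` AND `τ₁, τ₂`.  So the pair `(W, τ)` is determined, up to unitary
equivalence, by the representation `τ|M₀` on the vacuum subspace; with `WeylSystemCommutingAction` (irreducibility of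
`(W, τ)` ⇔ irreducibility of `τ|M₀`) this is the gluing step of the adelic uniqueness of `ρ_ψ`
[GelbartRogawski1991, §3.1 p. 454 L20–21].  Everything is PROVED (Mathlib + tree).

## References

* [vonNeumann1931] J. von Neumann, Die Eindeutigkeit der Schrödingerschen Operatoren, Math. Ann. 104 (1931)
  570–578, §5.
* [Folland1989] G. B. Folland, *Harmonic Analysis in Phase Space*, Princeton University Press, 1989, §1.5
  Theorem (1.50) (doi:10.1515/9781400882427).
-/

noncomputable section

open MeasureTheory Complex Filter
open scoped InnerProductSpace FourierTransform ComplexConjugate Topology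

namespace Literature.RepresentationTheory.HeisenbergGroup

open Literature.RepresentationTheory.Unitary

variable {V : Type*} [NormedAddCommGroup V] [InnerProductSpace ℝ V] [FiniteDimensional ℝ V]
  [MeasurableSpace V] [BorelSpace V]
variable {E₁ : Type*} [NormedAddCommGroup E₁] [InnerProductSpace ℂ E₁] [CompleteSpace E₁]
variable {E₂ : Type*} [NormedAddCommGroup E₂] [InnerProductSpace ℂ E₂] [CompleteSpace E₂]

namespace IsWeylSystem

variable {J : V →ₗ[ℝ] V} {W₁ : V → E₁ →L[ℂ] E₁} {W₂ : V → E₂ →L[ℂ] E₂}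
variable {G : Type*} [Group G]

/-- **Gluing**: an operator that is isometric on the vacuum subspace `M₁`, maps it onto `M₂` and intertwines the
commuting actions there extends to a unitary intertwining both the Weyl systems and the actions.
[cite: vonNeumann1931, §5] -/
theorem exists_linearIsometryEquiv_of_vacuumIntertwiner (hW₁ : IsWeylSystem J W₁) (hW₂ : IsWeylSystem J W₂)
    (τ₁ : Representation ℂ G E₁) (τ₂ : Representation ℂ G E₂)
    (h₁u : ∀ (g : G) (v : E₁), ‖τ₁ g v‖ = ‖v‖) (h₂u : ∀ (g : G) (v : E₂), ‖τ₂ g v‖ = ‖v‖)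
    (h₁W : ∀ (g : G) (x : V) (v : E₁), τ₁ g (W₁ x v) = W₁ x (τ₁ g v))
    (h₂W : ∀ (g : G) (x : V) (v : E₂), τ₂ g (W₂ x v) = W₂ x (τ₂ g v))
    (T : E₁ →L[ℂ] E₂) (hTn : ∀ m ∈ hW₁.vacuumSubspace, ‖T m‖ = ‖m‖)
    (hTm : ∀ m ∈ hW₁.vacuumSubspace, T m ∈ hW₂.vacuumSubspace)
    (hTs : ∀ m₂ ∈ hW₂.vacuumSubspace, ∃ m₁ ∈ hW₁.vacuumSubspace, T m₁ = m₂)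
    (hTτ : ∀ (g : G), ∀ m ∈ hW₁.vacuumSubspace, T (τ₁ g m) = τ₂ g (T m)) :
    ∃ U : E₁ ≃ₗᵢ[ℂ] E₂, (∀ m ∈ hW₁.vacuumSubspace, U m = T m) ∧
      (∀ (x : V) (v : E₁), U (W₁ x v) = W₂ x (U v)) ∧ ∀ (g : G) (v : E₁), U (τ₁ g v) = τ₂ g (U v) := by
  -- `T` restricted to `M₁` as a linear isometry
  let T₀ : hW₁.vacuumSubspace →ₗᵢ[ℂ] E₂ :=
    { toLinearMap := (T : E₁ →ₗ[ℂ] E₂).domRestrict hW₁.vacuumSubspace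
      norm_map' := fun m => hTn m m.2 }
  have hT₀app : ∀ m : hW₁.vacuumSubspace, T₀ m = T m := fun m => rfl
  obtain ⟨U, hUgen, hUW⟩ := hW₁.exists_linearIsometryEquiv_of_vacuumIsometry hW₂ T₀
    (fun m => by rw [hT₀app]; exact hTm m m.2)
    (fun m₂ hm₂ => by
      obtain ⟨m₁, hm₁, h⟩ := hTs m₂ hm₂
      exact ⟨⟨m₁, hm₁⟩, by rw [hT₀app]; exact h⟩)
  have hUm : ∀ m ∈ hW₁.vacuumSubspace, U m = T m := fun m hm => by
    have h := hUgen 0 ⟨m, hm⟩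
    rwa [hW₁.apply_zero, hW₂.apply_zero, hT₀app] at h
  refine ⟨U, hUm, hUW, fun g => ?_⟩
  -- `U ∘ τ₁ g` and `τ₂ g ∘ U` agree on the total family `W₁ x m`, `m ∈ M₁`
  set A₁ : E₁ →L[ℂ] E₁ := ⟨τ₁ g, continuous_rep_of_norm_eq τ₁ h₁u g⟩ with hA₁
  set A₂ : E₂ →L[ℂ] E₂ := ⟨τ₂ g, continuous_rep_of_norm_eq τ₂ h₂u g⟩ with hA₂
  have key : (U.toContinuousLinearEquiv : E₁ →L[ℂ] E₂).comp A₁ =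
      A₂.comp (U.toContinuousLinearEquiv : E₁ →L[ℂ] E₂) := by
    refine continuousLinearMap_eq_of_eqOn_of_dense _ hW₁.dense_span_range_apply_vacuum _ _ ?_
    rintro ⟨x, m⟩
    change U (τ₁ g (W₁ x (m : E₁))) = τ₂ g (U (W₁ x (m : E₁)))
    have hm' : τ₁ g (m : E₁) ∈ hW₁.vacuumSubspace := hW₁.rep_mem_vacuumSubspace τ₁ h₁u h₁W g m.2
    rw [h₁W, hUW, hUm _ hm', hTτ g _ m.2, ← hUm _ m.2, hUW, h₂W]
  intro v
  have := congrArg (fun Φ : E₁ →L[ℂ] E₂ => Φ v) key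
  simpa [hA₁, hA₂] using this

end IsWeylSystem

end Literature.RepresentationTheory.HeisenbergGroup

end
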